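import Literature.AnabelianGeometry.EtaleTheta.SettingModelChiShear
import HarnessLib

/-!
# A model of the [EtTh] §1 root, reshape (B) STAGE 2, part F2c: the inner `b`-power automorphisms
# `x ↦ b^t x b^{-t}` of `F̂₂` and the three-parameter affine action `(Ẑ × Ẑ) ⋊ Ẑ^× → Aut(F̂₂)`

Mochizuki, *The étale theta function …*, Publ. RIMS **45** (2009) [EtTh], §1, Prop. 1.5 (iii) p. 23
[cite: MochizukiEtTh2009, Prop 1.5 (iii) p.23]: "`a ∈ Z ≅ Π^tp_X/Π^tp_Y` acts as follows:
`η̈^Θ ↦ η̈^Θ − 2a·log(Ü) − (a²/2)·log(q_X) + log(O^×_K̈)`". Layer L2 of the abc-iut cell, seat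
abc-iut-L2-t6 (gen 5): file **F2c** of the R78 cluster (STAGE 2 «Tate shear»), sequel of this seat's F2b
`SettingModelChiShear.lean`, over abc-iut-w5-d024's F2 `SettingModelChiTwist.lean` — consumed BY NAME.

WHY (abc-iut-L2-t12's computation, INBOX 2026-08-26T06:59Z). In the class-two quotient, with the deck
generator acted on by `σ : a ↦ a·b^{k(σ)}·c^{m(σ)}` (`c = ⁅a,b⁆`), one gets
`a⁻ⁿ(b^β c^γ, g)aⁿ = (b^{β+n·k} c^{γ − nβ − (n(n−1)/2)k + n·m}, g)`, so the printed `Z`-action law holds iff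
`[k] = 2κ(q̈) = κ(q_X)` AND `[m] = −κ(q̈)` (up to `log(O^×)`): the LINEAR term needs a THIRD parameter `m`; the
two-parameter action of F2b (shear + twist) fails the clause already at `n = 1`. A literal "c-shear"
`a ↦ a·c^m, b ↦ b` is NOT an exact one-parameter group of automorphisms of `F̂₂` (`⁅a·c^m, b⁆ ≠ ⁅a,b⁆` above
class 2), but the INNER automorphisms `Inn(b^t)` are, and have the same class-two shadow
(`b^{-m} a b^{m} = a·⁅a⁻¹, b^{-m}⁆ ≡ a·c^{m}` mod `γ₃`). THIS FILE (pure profinite group theory):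
* `innB t : F̂₂ ≃ₜ* F̂₂` — conjugation by `b^t` (`t ∈ Ẑ`, F2's `bPow`); `innBHom : Ẑ → Aut(F̂₂)`;
* the exact relations `twist_innB : θ_α ∘ Inn(b^t) = Inn(b^{α t}) ∘ θ_α`, `shear_innB : shear k ∘ Inn(b^t)
  = Inn(b^t) ∘ shear k`, `eHat_innB`;
* **`affTwist₃ : (Ẑ × Ẑ) ⋊_{diag} Ẑ^× →* Aut(F̂₂)`**, `⟨(m, k), α⟩ ↦ Inn(b^m) ∘ shear k ∘ θ_α`, and its
  restriction `affTwist₃Gfp` to `Γ = F̂₂ ×_Ẑ ℤ` (degree preserved; continuity) — STAGE 2 instantiates F4's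
  generic action with `σ ↦ ⟨(m σ, k σ), χ σ⟩`, `m, k` the two `χ`-cocycles `∓κ(q̈)`, `2κ(q̈)` (F3c);
* the Heisenberg levels: `hHat_innB` (EXACT: conjugation by `(0, t mod N, 0)` — unlike the shear, the
  inner automorphism descends to every level), `hHat_innB_of_hHat_x_eq_zero` (trivial on the degree-`0`
  part), `hHat_affTwist₃_of_level` (F4's level-wise local triviality), and
  `hHat_gfpFst_affTwist₃Gfp_of_gfpSnd_eq_one` (on degree-`0` elements of `Γ` the action IS the diagonal twist
  `diagTwist (χ_N α)`, so the F5 covering-tower proofs transfer verbatim to stage 2).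
SEMI-SYNTHETIC MODEL, CONSISTENCY EVIDENCE ONLY; post-freeze class (b) CONSTRUCTION over the frozen interface
(no interface clause touched). Nothing of [EtTh] is asserted; no side is taken on [IUTchIII] Cor. 3.12.
-/

noncomputable section

namespace Literature.AnabelianGeometry.EtaleTheta.SettingModel

open Literature.AnabelianGeometry.SemiGraphs
open Literature.AnabelianGeometry.AbsoluteAnabelian
open CategoryTheory Function

/-- `Ẑ` is commutative (componentwise in the finite quotients `ℤ/N`). [folklore] -/
private theorem zh_mul_comm (a b : ZH) : a * b = b * a := by
  apply Subtype.ext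
  funext N
  change a.val N * b.val N = b.val N * a.val N
  have key : ∀ p q : Multiplicative ℤ ⧸ N.toSubgroup, p * q = q * p := fun p q => _root_.mul_comm p q
  exact key (a.val N) (b.val N)

/-! ### The inner automorphisms `Inn(b^t)` -/

/-- **`Inn(b^t) : F̂₂ ≃ₜ* F̂₂`**, `x ↦ b^t · x · b^{-t}`. [cite: MochizukiEtTh2009, Prop 1.5 (iii) p.23] -/
def innB (t : ZH) : F₂hatT ≃ₜ* F₂hatT :=
  { MulAut.conj (bPow t) with
    continuous_toFun := (continuous_const.mul continuous_id).mul continuous_const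
    continuous_invFun := (continuous_const.mul continuous_id).mul continuous_const }

/-- `Inn(b^t) x = b^t x b^{-t}`. [cite: MochizukiEtTh2009, Prop 1.5 (iii) p.23] -/
theorem innB_apply (t : ZH) (x : F₂hatT) : innB t x = bPow t * x * (bPow t)⁻¹ := rfl

/-- **`Ẑ → Aut(F̂₂)`**, `t ↦ Inn(b^t)`, a homomorphism (`MulAut.conj ∘ b^·`). [cite: MochizukiEtTh2009, Prop 1.5 (iii) p.23] -/
def innBHom : ZH →* MulAut F₂hatT := MulAut.conj.comp bPow.toMonoidHom

/-- `innBHom t x = Inn(b^t) x`. [cite: MochizukiEtTh2009, Prop 1.5 (iii) p.23] -/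
theorem innBHom_apply (t : ZH) (x : F₂hatT) : innBHom t x = innB t x := rfl

/-- `Inn(b^1) = id` on elements (`1 ∈ Ẑ` multiplicatively). [cite: MochizukiEtTh2009, Prop 1.5 (iii) p.23] -/
theorem innB_one (x : F₂hatT) : innB 1 x = x := by
  rw [innB_apply, map_one, one_mul, inv_one, mul_one]

/-- `Inn(b^{t t'}) = Inn(b^t) ∘ Inn(b^{t'})` on elements. [cite: MochizukiEtTh2009, Prop 1.5 (iii) p.23] -/
theorem innB_mul (t t' : ZH) (x : F₂hatT) : innB (t * t') x = innB t (innB t' x) := by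
  change innBHom (t * t') x = innBHom t (innBHom t' x)
  rw [map_mul]; rfl

/-- `Inn(b^t)` fixes `b^Ẑ` (commutative). [cite: MochizukiEtTh2009, Prop 1.5 (iii) p.23] -/
theorem innB_bPow (t u : ZH) : innB t (bPow u) = bPow u := by
  rw [innB_apply, ← map_mul, zh_mul_comm t u, map_mul, mul_inv_cancel_right]

/-! ### Relations with the twist and the shear; `ê`-invariance -/

/-- **`θ_α ∘ Inn(b^t) = Inn(b^{α t}) ∘ θ_α`**. [cite: MochizukiEtTh2009, Prop 1.5 (iii) p.23] -/
theorem twist_innB (α : MulAut ZH) (t : ZH) (x : F₂hatT) :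
    twist α (innB t x) = innB (α t) (twist α x) := by
  rw [innB_apply, innB_apply, map_mul, map_mul, map_inv, twist_bPow]

/-- **`shear k ∘ Inn(b^t) = Inn(b^t) ∘ shear k`** (the shear fixes `b^t`). [cite: MochizukiEtTh2009, Prop 1.5 (iii) p.23] -/
theorem shear_innB (k t : ZH) (x : F₂hatT) : shear k (innB t x) = innB t (shear k x) := by
  rw [innB_apply, innB_apply, map_mul, map_mul, map_inv, shear_bPow]

/-- `ê (Inn(b^t) x) = ê x` (`ê` is a homomorphism to the commutative `Ẑ`). [cite: MochizukiEtTh2009, Prop 1.5 (iii) p.23] -/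
theorem eHat_innB (t : ZH) (x : F₂hatT) : eHat (innB t x) = eHat x := by
  rw [innB_apply, map_mul, map_mul, map_inv, zh_mul_comm (eHat (bPow t)) (eHat x), mul_inv_cancel_right]

/-! ### The three-parameter affine action -/

/-- The diagonal action of `Aut(Ẑ)` on `Ẑ × Ẑ`. [cite: MochizukiEtTh2009, Prop 1.5 (iii) p.23] -/
def diagAut : MulAut ZH →* MulAut (ZH × ZH) where
  toFun α := MulEquiv.prodCongr α α
  map_one' := MulEquiv.ext fun _ => rfl
  map_mul' _ _ := MulEquiv.ext fun _ => rfl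

/-- [cite: MochizukiEtTh2009, Prop 1.5 (iii) p.23] -/
@[simp] theorem diagAut_apply (α : MulAut ZH) (v : ZH × ZH) : diagAut α v = (α v.1, α v.2) := rfl

/-- F2b's two-parameter action intertwines the inner `b`-powers through the cyclotomic part:
`affTwist ⟨k, α⟩ ∘ Inn(b^t) = Inn(b^{α t}) ∘ affTwist ⟨k, α⟩`. [cite: MochizukiEtTh2009, Prop 1.5 (iii) p.23] -/
theorem affTwist_innB (k : ZH) (α : MulAut ZH) (t : ZH) (x : F₂hatT) :
    affTwist ⟨k, α⟩ (innB t x) = innB (α t) (affTwist ⟨k, α⟩ x) := by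
  rw [affTwist_apply, affTwist_apply, twist_innB, shear_innB]

/-- The three-parameter composite `Inn(b^m) ∘ shear k ∘ θ_α` obeys the semidirect-product law of
`(Ẑ × Ẑ) ⋊_{diag} Ẑ^×`. [cite: MochizukiEtTh2009, Prop 1.5 (iii) p.23] -/
theorem innB_affTwist_mul (m k : ZH) (α : MulAut ZH) (m' k' : ZH) (α' : MulAut ZH) (x : F₂hatT) :
    innB m (affTwist ⟨k, α⟩ (innB m' (affTwist ⟨k', α'⟩ x))) =
      innB (m * α m') (affTwist (⟨k, α⟩ * ⟨k', α'⟩) x) := by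
  rw [affTwist_innB, ← innB_mul, map_mul, MulAut.mul_apply]

/-- **The three-parameter affine action** `(Ẑ × Ẑ) ⋊_{diag} Ẑ^× → Aut(F̂₂)`,
`⟨(m, k), α⟩ ↦ Inn(b^m) ∘ shear k ∘ θ_α` (inner `b`-power, shear and cyclotomic twist), a homomorphism by the
exact relations `twist_innB`, `twist_shear`, `shear_innB`. [cite: MochizukiEtTh2009, Prop 1.5 (iii) p.23] -/
def affTwist₃ : ((ZH × ZH) ⋊[diagAut] MulAut ZH) →* MulAut F₂hatT where
  toFun g := innBHom g.left.1 * affTwist ⟨g.left.2, g.right⟩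
  map_one' := by
    refine MulEquiv.ext fun x => ?_
    rw [SemidirectProduct.one_left, SemidirectProduct.one_right, Prod.fst_one, Prod.snd_one, MulAut.mul_apply,
      innBHom_apply, innB_one, MulAut.one_apply]
    change affTwist 1 x = x
    rw [map_one, MulAut.one_apply]
  map_mul' g g' := by
    refine MulEquiv.ext fun x => ?_
    simp only [MulAut.mul_apply, innBHom_apply, SemidirectProduct.mul_left, SemidirectProduct.mul_right,
      Prod.fst_mul, Prod.snd_mul, diagAut_apply]
    rw [innB_affTwist_mul]
    rfl

/-- `affTwist₃ ⟨(m,k),α⟩ x = Inn(b^m) (shear k (θ_α x))`. [cite: MochizukiEtTh2009, Prop 1.5 (iii) p.23] -/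
theorem affTwist₃_apply (g : (ZH × ZH) ⋊[diagAut] MulAut ZH) (x : F₂hatT) :
    affTwist₃ g x = innB g.left.1 (shear g.left.2 (twist g.right x)) := rfl

/-- With trivial inner part `m = 1` the action is F2b's two-parameter `affTwist`.
[cite: MochizukiEtTh2009, Prop 1.5 (iii) p.23] -/
theorem affTwist₃_of_fst_eq_one (g : (ZH × ZH) ⋊[diagAut] MulAut ZH) (hg : g.left.1 = 1) (x : F₂hatT) :
    affTwist₃ g x = affTwist ⟨g.left.2, g.right⟩ x := by
  rw [affTwist₃_apply, hg, innB_one, affTwist_apply]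

/-- The pure twist inside the three-parameter action. [cite: MochizukiEtTh2009, Prop 1.5 (iii) p.23] -/
theorem affTwist₃_inr (α : MulAut ZH) (x : F₂hatT) : affTwist₃ (SemidirectProduct.inr α) x = twist α x := by
  rw [affTwist₃_apply, SemidirectProduct.left_inr, SemidirectProduct.right_inr, Prod.fst_one, Prod.snd_one,
    innB_one, shear_one]

/-- Each `affTwist₃ g` is continuous. [cite: MochizukiEtTh2009, Prop 1.5 (iii) p.23] -/
theorem continuous_affTwist₃ (g : (ZH × ZH) ⋊[diagAut] MulAut ZH) : Continuous (affTwist₃ g : F₂hatT → F₂hatT) :=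
  (innB g.left.1).continuous.comp ((shear g.left.2).continuous.comp (twist g.right).continuous)

/-- `ê (affTwist₃ g x) = ê x` (F4's `hΦe` at stage 2). [cite: MochizukiEtTh2009, Prop 1.5 (iii) p.23] -/
theorem eHat_affTwist₃ (g : (ZH × ZH) ⋊[diagAut] MulAut ZH) (x : F₂hatT) : eHat (affTwist₃ g x) = eHat x := by
  rw [affTwist₃_apply, eHat_innB, eHat_shear, eHat_twist]

/-! ### The action on `Γ = F̂₂ ×_Ẑ ℤ` -/

/-- The action preserves membership in `Γ`. [cite: MochizukiEtTh2009, Prop 1.5 (iii) p.23] -/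
theorem affTwist₃_mem_Gfp (g : (ZH × ZH) ⋊[diagAut] MulAut ZH) {q : F₂hatT × Multiplicative ℤ}
    (hq : q ∈ Gfp) : (affTwist₃ g q.1, q.2) ∈ Gfp := by
  rw [mem_Gfp] at hq ⊢
  change eHat (affTwist₃ g q.1) = iotaZ q.2
  rw [eHat_affTwist₃]
  exact hq

/-- `affTwist₃ g × id` restricted to `Γ`, as a group automorphism. [cite: MochizukiEtTh2009, Prop 1.5 (iii) p.23] -/
def affTwist₃GfpEquiv (g : (ZH × ZH) ⋊[diagAut] MulAut ZH) : Gfp ≃* Gfp where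
  toFun q := ⟨(affTwist₃ g (q : F₂hatT × Multiplicative ℤ).1, (q : F₂hatT × Multiplicative ℤ).2),
    affTwist₃_mem_Gfp g q.2⟩
  invFun q := ⟨(affTwist₃ g⁻¹ (q : F₂hatT × Multiplicative ℤ).1, (q : F₂hatT × Multiplicative ℤ).2),
    affTwist₃_mem_Gfp g⁻¹ q.2⟩
  left_inv q := Subtype.ext (Prod.ext (by
    change affTwist₃ g⁻¹ (affTwist₃ g _) = _
    rw [← MulAut.mul_apply, ← map_mul, inv_mul_cancel, map_one, MulAut.one_apply]) rfl)
  right_inv q := Subtype.ext (Prod.ext (by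
    change affTwist₃ g (affTwist₃ g⁻¹ _) = _
    rw [← MulAut.mul_apply, ← map_mul, mul_inv_cancel, map_one, MulAut.one_apply]) rfl)
  map_mul' q q' := Subtype.ext (Prod.ext (map_mul (affTwist₃ g) _ _) rfl)

/-- **`(Ẑ × Ẑ) ⋊ Ẑ^× → Aut(Γ)`** — the stage-2 action on `Γ` (through which `Γ ⋊ G_{ℚ_p}` is formed).
[cite: MochizukiEtTh2009, Prop 1.5 (iii) p.23] -/
def affTwist₃Gfp : ((ZH × ZH) ⋊[diagAut] MulAut ZH) →* MulAut Gfp where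
  toFun := affTwist₃GfpEquiv
  map_one' := MulEquiv.ext fun _ => Subtype.ext (Prod.ext (by
    change affTwist₃ 1 _ = _; rw [map_one, MulAut.one_apply]; rfl) rfl)
  map_mul' g g' := MulEquiv.ext fun _ => Subtype.ext (Prod.ext (by
    change affTwist₃ (g * g') _ = affTwist₃ g (affTwist₃ g' _); rw [map_mul, MulAut.mul_apply]) rfl)

/-- `pr₁ ∘ affTwist₃Gfp g = affTwist₃ g ∘ pr₁`. [cite: MochizukiEtTh2009, Prop 1.5 (iii) p.23] -/
theorem gfpFst_affTwist₃Gfp (g : (ZH × ZH) ⋊[diagAut] MulAut ZH) (q : Gfp) :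
    gfpFst (affTwist₃Gfp g q) = affTwist₃ g (gfpFst q) := rfl

/-- `pr₂ ∘ affTwist₃Gfp g = pr₂` (degree preserved). [cite: MochizukiEtTh2009, Prop 1.5 (iii) p.23] -/
theorem gfpSnd_affTwist₃Gfp (g : (ZH × ZH) ⋊[diagAut] MulAut ZH) (q : Gfp) :
    gfpSnd (affTwist₃Gfp g q) = gfpSnd q := rfl

/-- Each `affTwist₃Gfp g` is continuous. [cite: MochizukiEtTh2009, Prop 1.5 (iii) p.23] -/
theorem continuous_affTwist₃Gfp (g : (ZH × ZH) ⋊[diagAut] MulAut ZH) :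
    Continuous (affTwist₃Gfp g : Gfp → Gfp) := by
  refine Continuous.subtype_mk ?_ _
  exact ((continuous_affTwist₃ g).comp (continuous_fst.comp continuous_subtype_val)).prodMk
    (continuous_snd.comp continuous_subtype_val)

/-! ### The Heisenberg levels -/

/-- **`ĥ_N (Inn(b^t) x) = (0, t mod N, 0) · ĥ_N x · (0, t mod N, 0)⁻¹`** — the inner automorphism DESCENDS to
every level (exactly, unlike the shear). [cite: MochizukiEtTh2009, Prop 1.5 (iii) p.23] -/
theorem hHat_innB (N : ℕ+) (t : ZH) (x : F₂hatT) :
    hHat N (innB t x) = hHat N (bPow t) * hHat N x * (hHat N (bPow t))⁻¹ := by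
  rw [innB_apply, map_mul, map_mul, map_inv]

/-- On elements whose level has `x`-coordinate `0` (e.g. `Ker ê = Δ̂_Y`) the inner `b`-power is level-trivial
(`(0,t,0)` commutes with `(0,y,z)`). [cite: MochizukiEtTh2009, Prop 1.5 (iii) p.23] -/
theorem hHat_innB_of_hHat_x_eq_zero (N : ℕ+) (t : ZH) {x : F₂hatT} (hx : (hHat N x).x = 0) :
    hHat N (innB t x) = hHat N x := by
  rw [hHat_innB, hHat_bPow]
  ext <;> simp [hx]

/-- `ê x = 1 → ĥ_N (Inn(b^t) x) = ĥ_N x`. [cite: MochizukiEtTh2009, Prop 1.5 (iii) p.23] -/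
theorem hHat_innB_of_eHat_eq_one (N : ℕ+) (t : ZH) {x : F₂hatT} (hx : eHat x = 1) :
    hHat N (innB t x) = hHat N x :=
  hHat_innB_of_hHat_x_eq_zero N t (hHat_x_eq_zero_of_eHat_eq_one N hx)

/-- If `t ∈ N·Ẑ` then `Inn(b^t)` is level-`N`-trivial (`ĥ_N (b^t) = 1`). [cite: MochizukiEtTh2009, Prop 1.5 (iii) p.23] -/
theorem hHat_innB_of_level_eq_one (N : ℕ+) {t : ZH} (ht : ZHatLevel.level N t = 1) (x : F₂hatT) :
    hHat N (innB t x) = hHat N x := by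
  have hb : hHat N (bPow t) = 1 := by
    rw [hHat_bPow, ht, toAdd_one]; rfl
  rw [hHat_innB, hb, one_mul, inv_one, mul_one]

/-- **Level-wise triviality of the three-parameter action** (F4's `hloc` at stage 2): if `m, k ∈ N·Ẑ` and
`χ_N(α) = 1` then `ĥ_N (affTwist₃ ⟨(m,k),α⟩ x) = ĥ_N x`. [cite: MochizukiEtTh2009, Prop 1.5 (iii) p.23] -/
theorem hHat_affTwist₃_of_level (N : ℕ+) {m k : ZH} {α : MulAut ZH} (hm : ZHatLevel.level N m = 1)
    (hk : ZHatLevel.level N k = 1) (hα : ZHatLevel.levelChar N α = 1) (x : F₂hatT) :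
    hHat N (affTwist₃ ⟨(m, k), α⟩ x) = hHat N x := by
  rw [affTwist₃_apply, hHat_innB_of_level_eq_one N hm, hHat_shear_of_level_eq_one N hk, hHat_twist, hα]
  ext <;> simp

/-- On `Γ`, for `q` of degree `0`: the stage-2 action on `ĥ_N` IS the diagonal twist `diagTwist (χ_N α)` — inner
part and shear are level-trivial there — so every `Y_N`/`Z_N` normality/stability proof of the diagonal model
transfers verbatim. [cite: MochizukiEtTh2009, Prop 1.5 (iii) p.23] -/
theorem hHat_gfpFst_affTwist₃Gfp_of_gfpSnd_eq_one (N : ℕ+) (m k : ZH) (α : MulAut ZH) {q : Gfp}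
    (hq : gfpSnd q = 1) :
    hHat N (gfpFst (affTwist₃Gfp ⟨(m, k), α⟩ q)) =
      Heis.diagTwist (ZHatLevel.levelChar N α) (hHat N (gfpFst q)) := by
  have h := (mem_Gfp _).mp q.2
  rw [gfpSnd_apply] at hq
  have he : eHat (gfpFst q) = 1 := by rw [gfpFst_apply, h, hq, map_one]
  rw [gfpFst_affTwist₃Gfp, affTwist₃_apply,
    hHat_innB_of_eHat_eq_one N m (by rw [eHat_shear, eHat_twist, he]),
    hHat_shear_of_eHat_eq_one N k (by rw [eHat_twist, he]), hHat_twist]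

end Literature.AnabelianGeometry.EtaleTheta.SettingModel

end
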